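import Literature.NumberTheory.Sieve.FriedlanderIwaniecPrimes
import HarnessLib

/-!
# Friedlander–Iwaniec, *The polynomial `X² + Y⁴` captures its primes*: hypothesis (2.8) fails as printed

Family `parity`, statement parity.S17. Source: J. Friedlander, H. Iwaniec, Ann. of Math. (2) 148
(1998), 945–1040 [FriedlanderIwaniecAnnals1998] (= arXiv:math/9811185), §2 (2.8) and §3, the
paragraph after Proposition 3.5.

`Literature.NumberTheory.Sieve.FriedlanderIwaniecPrimes` vendors, as the named fact
`Literature.NumberTheory.Sieve.FriedlanderIwaniec1998_hyp28`, hypothesis (2.8) of Proposition 2.1 for the sequence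
`a_n = #{(a, c) ∈ ℤ² : a² + c⁴ = n}` (4.1), in its printed form: "`A_d(x) ≪ d⁻¹ τ(d)⁸ A(x)`
uniformly in `d ≤ x^{1/3}`", which §3 calls "obvious in our case. More precisely, one can derive by
elementary arguments that `A_d(x) ≪ d⁻¹ τ(d) A(x)` uniformly for `d ≤ x^{1/2−ε}` in place of
(2.8)". **Read literally — for all moduli `d ≤ x^{1/3}`, with one implied constant — this is
false**, and this file PROVES its negation, `FriedlanderIwaniec1998_hyp28_false`:

for a prime `p` and `d = p⁴`, every pair `(p² a₁, p c₁)` with `a₁² + c₁⁴ = m` solves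
`a² + c⁴ = p⁴ m`, so `A_{p⁴}(x) ≥ A(x/p⁴) ≥ 2κ x^{3/4} p^{-3}` (`fiCount_div_le_congrSum`,
`FriedlanderIwaniecPrimes.fiCount_bounds`), whereas (2.8) would give
`A_{p⁴}(x) ≤ K τ(p⁴)⁸ p^{-4} A(x) ≤ 6κ K 5⁸ x^{3/4} p^{-4}`; for `p > 3 · 5⁸ K` and `x` large this is
absurd. (The "singular" solutions `p² ∣ a`, `p ∣ c` make `A_{p⁴}(x)` as large as
`≍ A(x) d^{-3/4}` at `d = p⁴`; the same happens for every modulus divisible by the fourth power of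
a large prime. Cubefree moduli — the only ones entering (2.9) and (3.19) — have no such solutions
beyond the expected number (`ν(p) ≤ 2p`, `ν(p²) ≤ 3p²` pairs `(α, c) mod p^k` with
`p^k ∣ α² + c⁴`), which is presumably what the remark in §3 has in mind.)

This does not bear on Theorem 1 as printed, only on the bookkeeping of hypotheses in its
formalisation: by Harman's account of the companion paper (*Prime-Detecting Sieves*, proof of
Thm 12.3, p. 249), the crude bound (2.8) serves only to pass from (2.9), (2.11) to their
`τ₅`-weighted forms ((12.9.18)–(12.9.19) there; [FriedlanderIwaniecASP1998], pp. 1046–1047), after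
which it "makes no further appearance in the proof". Consequences for the discharge DAG of
parity.S17: the named fact `FriedlanderIwaniec1998_hyp28` can never be discharged, the reductions
`friedlanderIwaniecSum_isEquivalent_of_inputs` (`FriedlanderIwaniecPrimes`) and
`setOf_prime_sq_add_pow_four_infinite_of_inputs` (`FriedlanderIwaniecPrimesInfinitude`) are vacuous
in that hypothesis, and Proposition 2.1 has to be re-vendored with the form of (2.8) that its proof
actually consumes (restricted to cubefree moduli, or averaged with divisor weights) — left to a
successor file working from the companion paper's text.

## Contents

* `fiRepCount_le_fiRepCount_pow_four_mul` — `a_m ≤ a_{k⁴ m}` (`k ≥ 1`), by `(a, c) ↦ (k² a, k c)`;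
* `fiCount_div_le_congrSum` — `A(x / k⁴) ≤ A_{k⁴}(x)`;
* **`FriedlanderIwaniec1998_hyp28_false : ¬ FriedlanderIwaniec1998_hyp28`**.

## References

* J. Friedlander, H. Iwaniec, *The polynomial `X² + Y⁴` captures its primes*, Ann. of Math. (2)
  148 (1998), 945–1040, doi:10.2307/121034 = arXiv:math/9811185: §2 (2.8); §3, paragraph after
  Proposition 3.5. [cite: FriedlanderIwaniecAnnals1998]
* J. Friedlander, H. Iwaniec, *Asymptotic sieve for primes*, Ann. of Math. (2) 148 (1998),
  1041–1065, doi:10.2307/121035, §2 (the use of (1.6)). [cite: FriedlanderIwaniecASP1998]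
* G. Harman, *Prime-Detecting Sieves*, LMS Monographs 33, Princeton 2007, §12.9, proof of
  Theorem 12.3, p. 249. [cite: Harman2007, §12.9 p. 249]
-/

noncomputable section

open Filter Asymptotics Finset
open scoped ArithmeticFunction.sigma Topology

namespace Literature.NumberTheory.Sieve

/-- `a_m ≤ a_{k⁴ m}` for `k ≥ 1`: `(a, c) ↦ (k² a, k c)` maps the solutions of `a² + c⁴ = m`
injectively into those of `a² + c⁴ = k⁴ m` (the "singular" solutions responsible for the failure
of (2.8) at `d = k⁴`). [folklore] -/
theorem fiRepCount_le_fiRepCount_pow_four_mul (m : ℕ) {k : ℕ} (hk : k ≠ 0) :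
    fiRepCount m ≤ fiRepCount (k ^ 4 * m) := by
  rw [fiRepCount, fiRepCount]
  refine card_le_card_of_injOn (fun ac => ((k : ℤ) ^ 2 * ac.1, (k : ℤ) * ac.2)) ?_ ?_
  · intro ac hac
    have h : ac.1 ^ 2 + ac.2 ^ 4 = (m : ℤ) := (mem_filter.mp (mem_coe.mp hac)).2
    have h' : ((k : ℤ) ^ 2 * ac.1) ^ 2 + ((k : ℤ) * ac.2) ^ 4 = ((k ^ 4 * m : ℕ) : ℤ) := by
      push_cast; rw [← h]; ring
    exact mem_coe.mpr (mem_filter.mpr ⟨mem_fiBox_of_eq h' le_rfl, h'⟩)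
  · rintro ⟨a, c⟩ _ ⟨a', c'⟩ _ h
    simp only [Prod.mk.injEq] at h
    obtain ⟨h1, h2⟩ := h
    have hk0 : (k : ℤ) ≠ 0 := by exact_mod_cast hk
    have hk2 : (k : ℤ) ^ 2 ≠ 0 := pow_ne_zero 2 hk0
    rw [Prod.mk.injEq]
    exact ⟨mul_left_cancel₀ hk2 h1, mul_left_cancel₀ hk0 h2⟩

/-- `A(x / k⁴) ≤ A_{k⁴}(x)` for `k ≥ 1`, `x ≥ 0`: `m ↦ k⁴ m` maps `[1, x/k⁴]` injectively into the
multiples of `k⁴` in `[1, x]`, and `a_m ≤ a_{k⁴ m}` (`fiRepCount_le_fiRepCount_pow_four_mul`).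
[folklore] -/
theorem fiCount_div_le_congrSum {k : ℕ} (hk : k ≠ 0) {x : ℝ} (hx : 0 ≤ x) :
    fiCount (x / (k : ℝ) ^ 4) ≤ fiSieveSeq.congrSum (k ^ 4) x := by
  rw [fiCount, SieveSequence.congrSum]
  have hk0 : (0 : ℝ) < k := by exact_mod_cast Nat.pos_of_ne_zero hk
  have hinj : Set.InjOn (fun m : ℕ => k ^ 4 * m) ↑(Icc 1 ⌊x / (k : ℝ) ^ 4⌋₊) :=
    fun a _ b _ h => Nat.eq_of_mul_eq_mul_left (by positivity) h
  have h1 : ∑ m ∈ Icc 1 ⌊x / (k : ℝ) ^ 4⌋₊, (fiRepCount m : ℝ) ≤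
      ∑ n ∈ (Icc 1 ⌊x / (k : ℝ) ^ 4⌋₊).image (fun m => k ^ 4 * m), (fiRepCount n : ℝ) := by
    rw [sum_image hinj]
    exact sum_le_sum fun m _ => by exact_mod_cast fiRepCount_le_fiRepCount_pow_four_mul m hk
  have hsub : (Icc 1 ⌊x / (k : ℝ) ^ 4⌋₊).image (fun m => k ^ 4 * m) ⊆
      (Ioc 0 ⌊x⌋₊).filter (k ^ 4 ∣ ·) := by
    intro n hn
    rw [mem_image] at hn
    obtain ⟨m, hm, rfl⟩ := hn
    rw [mem_Icc] at hm
    rw [mem_filter, mem_Ioc]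
    refine ⟨⟨Nat.mul_pos (pow_pos (Nat.pos_of_ne_zero hk) 4) (by omega), ?_⟩, dvd_mul_right _ _⟩
    apply Nat.le_floor
    have hm2 : (m : ℝ) ≤ x / (k : ℝ) ^ 4 := (Nat.le_floor_iff (by positivity)).mp hm.2
    rw [le_div_iff₀ (by positivity)] at hm2
    push_cast
    linarith
  calc ∑ m ∈ Icc 1 ⌊x / (k : ℝ) ^ 4⌋₊, (fiRepCount m : ℝ)
      ≤ ∑ n ∈ (Icc 1 ⌊x / (k : ℝ) ^ 4⌋₊).image (fun m => k ^ 4 * m), (fiRepCount n : ℝ) := h1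
    _ ≤ ∑ n ∈ (Ioc 0 ⌊x⌋₊).filter (k ^ 4 ∣ ·), (fiRepCount n : ℝ) :=
        sum_le_sum_of_subset_of_nonneg hsub fun _ _ _ => Nat.cast_nonneg _
    _ = _ := rfl

/-- **Hypothesis (2.8), as printed, fails for the sequence (4.1).** The named fact
`FriedlanderIwaniec1998_hyp28` — "`A_d(x) ≤ K τ(d)⁸ d⁻¹ A(x)` for all `1 ≤ d ≤ x^{1/3}`, `x`
large" (FI (2.8), asserted for this sequence in §3 after Proposition 3.5: "obvious in our case")
— is false: at `d = p⁴`, `p` prime, `A_{p⁴}(x) ≥ A(x/p⁴) ≥ 2κ x^{3/4} p^{-3}`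
(`fiCount_div_le_congrSum`, `FriedlanderIwaniecPrimes.fiCount_bounds`), while the bound would give
`≤ K · 5⁸ · p^{-4} · 6κ x^{3/4}`; taking `p > 3 · 5⁸ K` (`Nat.exists_infinite_primes`) and `x` large
is contradictory. See the file header for what this does and does not affect, and what has to be
re-vendored. [cite: FriedlanderIwaniecAnnals1998, §2 (2.8) and §3, paragraph after Proposition 3.5] -/
theorem FriedlanderIwaniec1998_hyp28_false : ¬FriedlanderIwaniec1998_hyp28 := by
  rintro ⟨K, hK⟩
  have hκ := friedlanderIwaniecKappa_pos
  -- a prime `p > 3 · 5⁸ · K`, `p ≥ 2`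
  obtain ⟨p, hpM, hp⟩ := Nat.exists_infinite_primes (⌈3 * 5 ^ 8 * K⌉₊ + 2)
  have hp2 : (2 : ℝ) ≤ p := by exact_mod_cast hp.two_le
  have hp0 : (0 : ℝ) < p := by linarith
  have hpK : 3 * 5 ^ 8 * K < p := by
    have h1 : 3 * 5 ^ 8 * K ≤ ⌈3 * 5 ^ 8 * K⌉₊ := Nat.le_ceil _
    have h2 : ((⌈3 * 5 ^ 8 * K⌉₊ + 2 : ℕ) : ℝ) ≤ p := by exact_mod_cast hpM
    push_cast at h2
    linarith
  have hpne : p ≠ 0 := hp.ne_zero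
  -- the size bounds at `x` and at `x / p⁴`, and (2.8) at `d = p⁴`, for one large `x`
  have hb := FriedlanderIwaniecPrimes.fiCount_bounds FriedlanderIwaniec1998_count_asymp_holds
  have hb' : ∀ᶠ x : ℝ in atTop, 2 * friedlanderIwaniecKappa * (x / (p : ℝ) ^ 4) ^ (3 / 4 : ℝ) ≤
      fiCount (x / (p : ℝ) ^ 4) :=
    (tendsto_id.atTop_div_const (by positivity : (0 : ℝ) < (p : ℝ) ^ 4)).eventually
      (hb.mono fun y hy => hy.1)
  obtain ⟨x, hKx, hbx, hb'x, hx12⟩ :=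
    (hK.and (hb.and (hb'.and (eventually_ge_atTop ((p : ℝ) ^ 12))))).exists
  have hx0 : (0 : ℝ) < x := lt_of_lt_of_le (by positivity) hx12
  -- `d = p⁴ ≤ x^{1/3}`
  have hd : (((p ^ 4 : ℕ) : ℕ) : ℝ) ≤ x ^ (1 / 3 : ℝ) := by
    have h12 : ((p : ℝ) ^ 12) ^ (1 / 3 : ℝ) ≤ x ^ (1 / 3 : ℝ) :=
      Real.rpow_le_rpow (by positivity) hx12 (by norm_num)
    have h4 : ((p : ℝ) ^ 12) ^ (1 / 3 : ℝ) = (p : ℝ) ^ 4 := by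
      rw [show ((p : ℝ) ^ 12) = ((p : ℝ) ^ 4) ^ (3 : ℕ) by ring,
        show (1 / 3 : ℝ) = ((3 : ℕ) : ℝ)⁻¹ by norm_num,
        Real.pow_rpow_inv_natCast (by positivity) (by norm_num)]
    push_cast
    linarith [h4 ▸ h12]
  have h28 := hKx (p ^ 4) (Nat.one_le_iff_ne_zero.mpr (pow_ne_zero 4 hpne)) hd
  -- `τ(p⁴) = 5`
  have hτ : (σ 0 (p ^ 4) : ℝ) = 5 := by
    rw [ArithmeticFunction.sigma_zero_apply_prime_pow hp]; norm_num
  rw [hτ] at h28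
  -- the chain `2κ (x/p⁴)^{3/4} ≤ A(x/p⁴) ≤ A_{p⁴}(x) ≤ K 5⁸ / p⁴ · A(x) ≤ K 5⁸ / p⁴ · 6κ x^{3/4}`
  have hlow := hb'x.trans (fiCount_div_le_congrSum hpne hx0.le)
  have hchain := hlow.trans h28
  have hsplit : (x / (p : ℝ) ^ 4) ^ (3 / 4 : ℝ) = x ^ (3 / 4 : ℝ) / (p : ℝ) ^ 3 := by
    rw [Real.div_rpow hx0.le (by positivity)]
    congr 1
    rw [show ((p : ℝ) ^ 4) = ((p : ℝ) ^ (4 : ℝ)) by norm_cast, ← Real.rpow_mul hp0.le]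
    norm_num
  rw [hsplit] at hchain
  have hA := hbx.2
  have hx34 : 0 < x ^ (3 / 4 : ℝ) := by positivity
  have hP4 : (((p ^ 4 : ℕ)) : ℝ) = (p : ℝ) ^ 4 := by push_cast; ring
  rw [hP4] at hchain
  have hp4 : (0 : ℝ) < (p : ℝ) ^ 4 := by positivity
  have e1 : 2 * friedlanderIwaniecKappa * (x ^ (3 / 4 : ℝ) / (p : ℝ) ^ 3) =
      (2 * friedlanderIwaniecKappa * x ^ (3 / 4 : ℝ) * p) / (p : ℝ) ^ 4 := by
    field_simp
  have e2 : K * 5 ^ 8 / (p : ℝ) ^ 4 * fiCount x = (K * 5 ^ 8 * fiCount x) / (p : ℝ) ^ 4 := by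
    ring
  rw [e1, e2, div_le_div_iff_of_pos_right hp4] at hchain
  -- `hchain : 2κ x^{3/4} p ≤ K 5⁸ A(x)`, `A(x) ≤ 6κ x^{3/4}`, `2κ x^{3/4} ≤ A(x)`, `3 · 5⁸ K < p`
  have hpos : 0 < 2 * friedlanderIwaniecKappa * x ^ (3 / 4 : ℝ) := by positivity
  have hb : 3 * 5 ^ 8 * K * (2 * friedlanderIwaniecKappa * x ^ (3 / 4 : ℝ)) <
      p * (2 * friedlanderIwaniecKappa * x ^ (3 / 4 : ℝ)) := mul_lt_mul_of_pos_right hpK hpos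
  rcases le_or_gt 0 K with hK0 | hK0
  · have ha : K * 5 ^ 8 * fiCount x ≤ K * 5 ^ 8 * (6 * friedlanderIwaniecKappa * x ^ (3 / 4 : ℝ)) :=
      mul_le_mul_of_nonneg_left hA (by positivity)
    linarith
  · have hF : 0 < fiCount x := lt_of_lt_of_le hpos hbx.1
    have hc : K * 5 ^ 8 * fiCount x < 0 := mul_neg_of_neg_of_pos (by linarith) hF
    have hd : 0 < 2 * friedlanderIwaniecKappa * x ^ (3 / 4 : ℝ) * p := by positivity
    linarith

end Literature.NumberTheory.Sieve

end
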